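import Literature.Geometry.Lorentzian.KerrLargeSuperradiantPotential
import HarnessLib

/-!
# The structure of the potential in the trapping range `𝓖_♮`
# (Dafermos–Rodnianski–Shlapentokh-Rothman, Lemma 8.6.1)

(family `gr`, infrastructure for statement **gr.S24**; namespace `Literature.Geometry.Lorentzian.Kerr`)

Dafermos–Rodnianski–Shlapentokh-Rothman (*Decay for solutions of the wave equation on Kerr exterior
spacetimes III*, arXiv:1402.7034 = Ann. of Math. 183 (2016)), Lemma 8.6.1: for `ε_width > 0`, all
`ω_high` sufficiently large depending on `ε_width` and `(ω, m, Λ) ∈ 𝓖_♮(ω_high, ε_width)`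
(admissible, `|ω| ≥ ω_high`, `ε_width Λ ≤ ω² ≤ ε_width⁻¹Λ`, off the near-superradiant strip) "there
exists an `r₃ ∈ (r₊, ∞]` depending on the frequency triple but bounded away from `r₊`,
`r₃ − r₊ ≥ b(ε_width)`, such that for `r ∈ [r₊, r₃]`, `V(r) ≤ ω² − b(ε_width)Λ`. Furthermore, in the
case when `r₃ < ∞`, then in fact `r₃ ≤ B`, `r⁰_max` exists and the potential `V` has a unique
non-degenerate maximum `r_max ∈ [r₃, ∞)`, `|r_max − r⁰_max| ≤ B(ε_width)Λ⁻¹` and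
`d²V/dr²(r_max) < −b(ε_width)Λ`." In the proof of Prop. 8.6.1 this structure ("in view of the
properties of `V` proven above") is what allows the construction of a multiplier `f` vanishing at
`r_trap = r_max` with `−fV' − ½f''' > bΛΔ(r − r_max)²r⁻⁷` on `[r₃, ∞)`, while on `(r₊, r₃]` only
`ω² − V ≥ bΛ` is used; when `r₃ = ∞` one sets `r_trap = 0`.

This file **proves** the lemma, for fixed `0 < M`, `0 ≤ a < M` (constants depending on `M, a` and on
`c`; the source's uniformity in `a ∈ [0, a₀]` is not transcribed), in the following explicit
dichotomy (`exists_sepPotential_trapping_structure`): given `c > 0` there are `Λ₀`, `d > 0`,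
`b > 0`, `B` such that for every admissible triple with `Λ ≥ Λ₀` and `ω² − V₀(r₊) ≥ cΛ` (the first
display of the printed proof; in `𝓖_♮(ω_high, ε)` with the repaired strip of
`KerrFrequencyRanges.lean` it holds with `c = min(ε, α²)`,
`KerrFrequencyRanges.min_mul_le_sq_sub_sepPotential₀_rPlus`), EITHER
* (`r₃ = ∞`) `V(r) ≤ ω² − bΛ` for all `r ≥ r₊`, OR
* (`r₃ < ∞`) there are `r₃ ∈ [r₊ + d, 6M]` and `r_max ∈ [r₃ + d, 7M)` with `V ≤ ω² − bΛ` on `[r₊, r₃]`,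
  `dV/dr > 0` on `[r₃, r_max)`, `dV/dr(r_max) = 0`, `dV/dr < 0` on `(r_max, ∞)`, `r_max` the maximum
  of `V` on `[r₃, ∞)`, the non-degeneracy `bΛ(r − r_max)²/r⁴ ≤ −(r − r_max)dV/dr(r)` for all
  `r ≥ r₃` and `d²V/dr²(r_max) ≤ −bΛ`, and a critical point `r⁰_max ∈ (r₊, 7M)` of `V₀` with
  `dV₀/dr < 0` on `(r⁰_max, ∞)` (the point `r⁰_max` of Lemma 6.3.1 (b)/(c)) and
  `|r_max − r⁰_max| ≤ B/Λ`;

and `exists_sepPotential_trapping_structure_of_isFreqNatural'` is the same statement for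
`(ω, m, Λ) ∈ 𝓖_♮(ω_high, ε)` and all `ω_high ≥ ω₀` ("for all `ω_high` sufficiently large depending
on `ε_width`"). Here `dV/dr` is the `r`-derivative; the printed `V' = (Δ/(r² + a²)) dV/dr`
(`' = d/dr*`) has the same sign and zeros on `(r₊, ∞)`.

The proof follows the printed one, organised around the cubic `P = (r² + a²)³dV₀/dr` and its
turning point `r₁` (`KerrSeparatedTrapping.exists_critPoly_turningPoint`: `dP/dr > 0` on `[r₊, r₁)`,
`dP/dr ≤ 0` at `r₁ ≤ 5M`, `dP/dr < 0` beyond — the source's "either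
`d/dr((r² + a²)³dV₀/dr)` is negative on `[r₊, ∞)` or there exists a unique value `r₁` …"), with
the two printed sub-cases "based on the value of `V₀(r₁)`" replaced by the value of `P(r₁)`:
* if `P(r₁) ≤ K₁Λ` (`K₁ = cM⁵/8`) then `P ≤ K₁Λ` on `[r₊, ∞)`, whence `V₀ ≤ V₀(r₊) + (3c/4)Λ` on
  `[r₊, ∞)` (`sepPotential₀_le_of_critPoly_le`; `V₀` decreases beyond `7M`) and `r₃ = ∞`;
* if `P(r₁) > K₁Λ`, the first point `s ∈ [r₊, r₁]` with `P(s) ≥ (K₁/2)Λ` splits `[r₊, r₁]` into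
  `[r₊, s]`, where `V₀ ≤ V₀(r₊) + (3c/8)Λ`, and `[s, r₁]`, where `P ≥ (K₁/2)Λ` ("we can find a value
  `r₀' ∈ [r₀, r₁]` such that `V₀ ≤ V₀(r₊) + (3c/4)Λ` on `[r₊, r₀']` and `dV₀/dr ≥ c₂Λ` on
  `[r₀', r₁]`"); the latter extends to `[s, r₁ + δ₂]` (`critPoly_ge_half_of_extend`, "the last
  property can be easily extended to a slightly larger interval"), and `dP/dr ≤ −c̃Λr²` on
  `[r₁ + δ₂, ∞)` (`critPolyDeriv_le_of_turningPoint`, the source's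
  "`d/dr((r² + a²)³dV₀/dr) < −c₃Λr²` on `[r₁ + δ, ∞)`"); `r₃ = max(s, r₊ + d)`.
The passage from `V₀` to `V = V₀ + V₁` for `Λ` large ("just as we argued in the frequency range
`𝓖^♯`, adding the bounded potential `V₁`, and requiring that `ω_high` is sufficiently large") is
`exists_sepPotential_structure_of_critPoly_sign`, the argument of
`KerrLargeSuperradiantPotential.exists_sepPotential_structure_of_horizon_deriv` (proof of
Lemma 8.3.1) run from an interior point `s₀ ≥ r₊` instead of `r₊`: inputs `P ≥ KΛ` on `[s₀, s₁]`,
`dP/dr ≤ −c̃Λr²` on `[s₁, ∞)`, `s₁ ≤ 6M`.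

No named facts (D-0026); everything is proved, with explicit constants.

## References

* M. Dafermos, I. Rodnianski, Y. Shlapentokh-Rothman, arXiv:1402.7034 = Ann. of Math. 183
  (2016), §8.6, Lemma 8.6.1 and its proof; §8.3, proof of Lemma 8.3.1
  (key `DafermosRodnianskiShlapentokhrothman2014`).
-/

noncomputable section

open Set Filter Topology

namespace Literature.Geometry.Lorentzian

namespace Kerr

/-! ### The cubic `P` around its turning point: quantitative consequences -/

/-- **`dP/dr ≤ −c̃Λt²` beyond the turning point, quantitatively**: if `dP/dr(r₁) ≤ 0` at a point
`r₁` with `|a| ≤ M ≤ r₁ ≤ 5M`, then for `0 < δ₂ ≤ M` and every `t ≥ r₁ + δ₂`,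
`dP/dr(t) ≤ −(2δ₂/(3M))Λt²` (`Λ ≥ 0`): from `dP/dr(t) ≤ −4Λt(t − r₁)`
(`critPolyDeriv_le_of_nonpos`) and `δ₂t ≤ (t − r₁)(r₁ + δ₂) ≤ 6M(t − r₁)`. The source's
"`d/dr((r² + a²)³dV₀/dr) < −c₃Λr²` for all `r ∈ [r₁ + δ, ∞)`, for a positive constant `c₃`"
(DRSR arXiv:1402.7034, proof of Lemma 8.6.1; likewise (aProp2) in the proof of Lemma 8.3.1).
[cite: DafermosRodnianskiShlapentokhrothman2014, Lemma 8.6.1 (proof)] -/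
theorem critPolyDeriv_le_of_turningPoint {M a ω Λ r₁ δ₂ t : ℝ} {m : ℤ} (hM : 0 < M)
    (haM : |a| ≤ M) (hΛ : 0 ≤ Λ) (hMr₁ : M ≤ r₁) (hr₁ : r₁ ≤ 5 * M)
    (hP : critPolyDeriv M a ω m Λ r₁ ≤ 0) (hδ₂ : 0 < δ₂) (hδ₂M : δ₂ ≤ M) (ht : r₁ + δ₂ ≤ t) :
    critPolyDeriv M a ω m Λ t ≤ -(2 * δ₂ / (3 * M) * Λ * t ^ 2) := by
  have hr₁0 : 0 < r₁ := hM.trans_le hMr₁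
  have ht0 : 0 < t := by linarith only [hr₁0, hδ₂, ht]
  have ha2 : a ^ 2 ≤ M ^ 2 := by nlinarith only [haM, abs_nonneg a, sq_abs a]
  have har : a ^ 2 ≤ r₁ ^ 2 := ha2.trans (pow_le_pow_left₀ hM.le hMr₁ 2)
  have h1 := critPolyDeriv_le_of_nonpos (ω := ω) (m := m) hΛ hr₁0 har hP
    (show r₁ ≤ t by linarith only [ht, hδ₂])
  have h2 : δ₂ * t ≤ (t - r₁) * (6 * M) := by
    have e0 : 0 ≤ r₁ * (t - (r₁ + δ₂)) := mul_nonneg hr₁0.le (by linarith only [ht])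
    have e1 : δ₂ * t ≤ (t - r₁) * (r₁ + δ₂) := by linarith only [e0]
    have e2 : (t - r₁) * (r₁ + δ₂) ≤ (t - r₁) * (6 * M) :=
      mul_le_mul_of_nonneg_left (by linarith only [hr₁, hδ₂M]) (by linarith only [ht, hδ₂])
    exact e1.trans e2
  have h3 : 4 * Λ * t * (δ₂ * t) ≤ 4 * Λ * t * ((t - r₁) * (6 * M)) :=
    mul_le_mul_of_nonneg_left h2 (by positivity)
  have e : 2 * δ₂ / (3 * M) * Λ * t ^ 2 = 4 * Λ * t * (δ₂ * t) / (6 * M) := by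
    field_simp; ring
  have h4 : 2 * δ₂ / (3 * M) * Λ * t ^ 2 ≤ 4 * Λ * t * (t - r₁) := by
    rw [e, div_le_iff₀ (by positivity)]; linarith only [h3]
  exact h1.trans (neg_le_neg h4)

/-- **Extending a lower bound for `P` slightly to the right** ("the last property can be easily
extended to a slightly larger interval", DRSR arXiv:1402.7034, proof of Lemma 8.6.1): if
`P ≥ KΛ` on `[s, r₁]` with `M ≤ s ≤ r₁`, `r₁ + δ₂ ≤ 6M` and `0 ≤ δ₂ ≤ K/(2592M²)`, then
`P ≥ (K/2)Λ` on `[s, r₁ + δ₂]` — by the mean value theorem with `|dP/dr| ≤ 36Λr² ≤ 1296ΛM²` on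
`[M, 6M]` (`abs_critPolyDeriv_le`). [cite: DafermosRodnianskiShlapentokhrothman2014, Lemma 8.6.1 (proof)] -/
theorem critPoly_ge_half_of_extend {M a ω Λ K s r₁ δ₂ : ℝ} {m : ℤ} (hM : 0 < M) (haM : |a| ≤ M)
    (hadm : IsAdmissibleTriple a ω m Λ) (hK : 0 ≤ K) (hMs : M ≤ s) (hsr₁ : s ≤ r₁)
    (hr₁6 : r₁ + δ₂ ≤ 6 * M) (hδ₂ : 0 ≤ δ₂) (hδ₂K : δ₂ ≤ K / (2592 * M ^ 2))
    (hP : ∀ r ∈ Icc s r₁, K * Λ ≤ critPoly M a ω m Λ r) :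
    ∀ r ∈ Icc s (r₁ + δ₂), K / 2 * Λ ≤ critPoly M a ω m Λ r := by
  intro r hr
  have hΛ : 0 ≤ Λ := hadm.nonneg
  have hMr₁ : M ≤ r₁ := hMs.trans hsr₁
  rcases le_or_gt r r₁ with hrr₁ | hrr₁
  · have h1 := hP r ⟨hr.1, hrr₁⟩
    have h2 : K / 2 * Λ ≤ K * Λ := by nlinarith only [hK, hΛ]
    exact h2.trans h1
  · -- mean value theorem on `[r₁, r]`
    have hmvt := (convex_Icc r₁ (r₁ + δ₂)).mul_sub_le_image_sub_of_le_deriv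
      (continuous_critPoly M a ω m Λ).continuousOn
      (fun x _ ↦ (hasDerivAt_critPoly M a ω m Λ x).differentiableAt.differentiableWithinAt)
      (C := -(1296 * Λ * M ^ 2))
      (fun x hx ↦ by
        rw [interior_Icc] at hx
        rw [deriv_critPoly]
        have hxM : M ≤ x := hMr₁.trans hx.1.le
        have hx6 : x ≤ 6 * M := hx.2.le.trans hr₁6
        have habs := abs_critPolyDeriv_le hM haM hadm hxM
        have hprod : 0 ≤ (6 * M - x) * (6 * M + x) :=
          mul_nonneg (by linarith only [hx6]) (by linarith only [hxM, hM])
        have hx2 : x ^ 2 ≤ 36 * M ^ 2 := by nlinarith only [hprod]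
        have h36 := mul_le_mul_of_nonneg_left hx2 (by positivity : (0 : ℝ) ≤ 36 * Λ)
        linarith only [habs, h36, neg_abs_le (critPolyDeriv M a ω m Λ x)])
      r₁ (left_mem_Icc.2 (by linarith only [hδ₂])) r ⟨hrr₁.le, hr.2⟩ hrr₁.le
    have hPr₁ := hP r₁ ⟨hsr₁, le_rfl⟩
    have hrc' : r - r₁ ≤ δ₂ := by linarith only [hr.2]
    have h1 : 1296 * Λ * M ^ 2 * (r - r₁) ≤ 1296 * Λ * M ^ 2 * δ₂ :=
      mul_le_mul_of_nonneg_left hrc' (by positivity)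
    have h2 : 1296 * Λ * M ^ 2 * δ₂ ≤ K / 2 * Λ := by
      have h := mul_le_mul_of_nonneg_left hδ₂K (by positivity : (0 : ℝ) ≤ 1296 * Λ * M ^ 2)
      have e : 1296 * Λ * M ^ 2 * (K / (2592 * M ^ 2)) = K / 2 * Λ := by
        field_simp; ring
      linarith only [h, e.le]
    linarith only [hmvt, hPr₁, h1, h2]

/-- **An upper bound for `P` bounds the growth of `V₀`**: if `P ≤ L` (`L ≥ 0`) on `[r₊, s]`
(`0 < M`, so `r > r₊ ≥ M > 0` there), then `V₀(r) ≤ V₀(r₊) + (L/M⁶)(r − r₊)` for `r ∈ [r₊, s]`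
(`dV₀/dr = P/(r² + a²)³ ≤ L/M⁶`). This quantifies the step "`r₀ − r₊` … is bounded from below by
a constant only depending on `ε_width`" / "`V₀(r) ≤ V₀(r₊) + (3c/4)Λ` for all `r ∈ [r₊, r₀']`" of
the proof of DRSR arXiv:1402.7034, Lemma 8.6.1. [cite: DafermosRodnianskiShlapentokhrothman2014, Lemma 8.6.1 (proof)] -/
theorem sepPotential₀_le_add_of_critPoly_le {M a ω Λ L s : ℝ} {m : ℤ} (hM : 0 < M) (hL : 0 ≤ L)
    (hP : ∀ r ∈ Icc (rPlus M a) s, critPoly M a ω m Λ r ≤ L) :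
    ∀ r ∈ Icc (rPlus M a) s,
      sepPotential₀ M a ω m Λ r ≤ sepPotential₀ M a ω m Λ (rPlus M a) + L / M ^ 6 * (r - rPlus M a) := by
  intro r hr
  have hrpM : M ≤ rPlus M a := M_le_rPlus M a
  have hrp0 : 0 < rPlus M a := hM.trans_le hrpM
  rcases eq_or_lt_of_le hr.1 with h | hlt
  · rw [← h]; simp
  have hmvt := (convex_Icc (rPlus M a) s).image_sub_le_mul_sub_of_deriv_le
    (f := sepPotential₀ M a ω m Λ)
    (continuousOn_sepPotential₀ M a ω m Λ (fun x hx ↦ hrp0.trans_le hx.1))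
    (fun x hx ↦ by
      have hx0 : (0 : ℝ) < x := by
        rw [interior_Icc] at hx; exact hrp0.trans hx.1
      exact (hasDerivAt_sepPotential₀_critPoly M a ω m Λ
        (by positivity : x ^ 2 + a ^ 2 ≠ 0)).differentiableAt.differentiableWithinAt)
    (C := L / M ^ 6)
    (fun x hx ↦ by
      rw [interior_Icc] at hx
      have hxM : M ≤ x := hrpM.trans hx.1.le
      have hx0 : 0 < x := hM.trans_le hxM
      have hD : 0 < x ^ 2 + a ^ 2 := by positivity
      rw [deriv_sepPotential₀_eq M a ω m Λ hD.ne']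
      have h1 : critPoly M a ω m Λ x / (x ^ 2 + a ^ 2) ^ 3 ≤ L / (x ^ 2 + a ^ 2) ^ 3 :=
        div_le_div_of_nonneg_right (hP x ⟨hx.1.le, hx.2.le⟩) (by positivity)
      have h2 : L / (x ^ 2 + a ^ 2) ^ 3 ≤ L / M ^ 6 := by
        apply div_le_div_of_nonneg_left hL (by positivity)
        calc M ^ 6 = (M ^ 2) ^ 3 := by ring
          _ ≤ (x ^ 2 + a ^ 2) ^ 3 := by
              gcongr; nlinarith only [pow_le_pow_left₀ hM.le hxM 2, sq_nonneg a]
      exact h1.trans h2)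
    (rPlus M a) (left_mem_Icc.2 (hr.1.trans hr.2)) r hr hlt.le
  linarith only [hmvt]

/-! ### From `V₀` to `V = V₀ + V₁`, starting from an interior point -/

/-- **The passage from `V₀` to `V = V₀ + V₁` for large `Λ`, run from an interior point** (the
argument of the proof of DRSR arXiv:1402.7034, Lemma 8.3.1, in the form needed for Lemma 8.6.1:
"just as we argued in the frequency range `𝓖^♯`, adding the bounded potential `V₁`, and requiring
that `ω_high` is sufficiently large finishes the proof"). For `0 < M`, `0 ≤ a < M` and constants
`K > 0`, `c̃ > 0` there are `Λ₀`, `b > 0`, `B` (depending on `M, a, K, c̃` only) such that: for every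
admissible triple `(ω, m, Λ)` with `Λ ≥ Λ₀` and all `r₊ ≤ s₀ ≤ s₁ ≤ 6M` with `P ≥ KΛ` on `[s₀, s₁]`
(`P = (r² + a²)³dV₀/dr`) and `dP/dr ≤ −c̃Λt²` for `t ≥ s₁`, there is
`r_max ∈ [s₁ + K/(3720M²), 7M)` (the gap from `g(s₁) ≥ (K/2)Λ` and `|dg/dr| ≤ 1860ΛM²` on `[M, 7M]`)
with `dV/dr > 0` on `[s₀, r_max)`, `dV/dr(r_max) = 0`, `dV/dr < 0` on `(r_max, ∞)`, `r_max` the maximum of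
`V` on `[s₀, ∞)`, `bΛ(r − r_max)²/r⁴ ≤ −(r − r_max)dV/dr(r)` for all `r ≥ s₀`,
`d²V/dr²(r_max) ≤ −bΛ`, and `|r_max − z| ≤ B/Λ` for every zero `z ≥ s₁` of `P`. (With
`g = (r² + a²)³dV/dr = P + (r² + a²)³dV₁/dr`: `g ≥ (K/2)Λ` on `[s₀, s₁]` and
`dg/dr ≤ −(c̃/2)Λr²` on `[s₁, ∞)` once `Λ ≥ max(132, 3584/c̃, 13248M³/K)`, using
`|(r² + a²)³dV₁/dr| ≤ 184Mr²`, `|d/dr((r² + a²)³dV₁/dr)| ≤ 1792Mr`; `g < 0` on `[7M, ∞)`.)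
Constants: `Λ₀ = max(132, 3584/c̃, 13248M³/K)`, `B = 9016M/c̃`,
`b = min(c̃/48, K/(4032M³), c̃/(38416M⁴))`. [cite: DafermosRodnianskiShlapentokhrothman2014, Lemma 8.6.1 (proof)] -/
theorem exists_sepPotential_structure_of_critPoly_sign {M a K ct : ℝ} (hM : 0 < M) (ha0 : 0 ≤ a)
    (haM : a < M) (hK : 0 < K) (hct0 : 0 < ct) :
    ∃ Λ₀ : ℝ, ∃ b > 0, ∃ B : ℝ, ∀ (ω : ℝ) (m : ℤ) (Λ : ℝ), IsAdmissibleTriple a ω m Λ →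
      Λ₀ ≤ Λ → ∀ s₀ s₁ : ℝ, rPlus M a ≤ s₀ → s₀ ≤ s₁ → s₁ ≤ 6 * M →
      (∀ r ∈ Icc s₀ s₁, K * Λ ≤ critPoly M a ω m Λ r) →
      (∀ t ∈ Ici s₁, critPolyDeriv M a ω m Λ t ≤ -(ct * Λ * t ^ 2)) →
      ∃ rmax : ℝ, s₁ + K / (3720 * M ^ 2) ≤ rmax ∧ rmax < 7 * M ∧
        (∀ r ∈ Ico s₀ rmax, 0 < deriv (sepPotential M a ω m Λ) r) ∧
        deriv (sepPotential M a ω m Λ) rmax = 0 ∧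
        (∀ r ∈ Ioi rmax, deriv (sepPotential M a ω m Λ) r < 0) ∧
        IsMaxOn (sepPotential M a ω m Λ) (Ici s₀) rmax ∧
        (∀ r ∈ Ici s₀,
          b * Λ * (r - rmax) ^ 2 / r ^ 4 ≤ -((r - rmax) * deriv (sepPotential M a ω m Λ) r)) ∧
        deriv (deriv (sepPotential M a ω m Λ)) rmax ≤ -(b * Λ) ∧
        (∀ z ∈ Ici s₁, critPoly M a ω m Λ z = 0 → |rmax - z| ≤ B / Λ) := by
  have haM' : |a| ≤ M := by rw [abs_of_nonneg ha0]; exact haM.le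
  have ha2 : a ^ 2 ≤ M ^ 2 := by nlinarith only [haM, ha0]
  -- `r₊`
  have hrp : M < rPlus M a := by
    have : 0 < √(M ^ 2 - a ^ 2) := Real.sqrt_pos.2 (by nlinarith only [haM, ha0])
    unfold rPlus; linarith only [this]
  have hrp0 : 0 < rPlus M a := hM.trans hrp
  -- the constants
  obtain ⟨Bc, hBcdef⟩ : ∃ Bc : ℝ, Bc = 9016 * M / ct := ⟨_, rfl⟩
  obtain ⟨Λ₀, hΛ₀def⟩ : ∃ Λ₀ : ℝ, Λ₀ = max 132 (max (3584 / ct) (13248 * M ^ 3 / K)) := ⟨_, rfl⟩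
  obtain ⟨b, hbdef⟩ : ∃ b : ℝ, b = min (ct / 48) (min (K / (4032 * M ^ 3)) (ct / (38416 * M ^ 4))) :=
    ⟨_, rfl⟩
  have hb0 : 0 < b := by
    rw [hbdef]; exact lt_min (by positivity) (lt_min (by positivity) (by positivity))
  have hb2 : b ≤ ct / 48 := by rw [hbdef]; exact min_le_left _ _
  have hb3 : b ≤ K / (4032 * M ^ 3) := by
    rw [hbdef]; exact (min_le_right _ _).trans (min_le_left _ _)
  have hb4 : b ≤ ct / (38416 * M ^ 4) := by
    rw [hbdef]; exact (min_le_right _ _).trans (min_le_right _ _)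
  refine ⟨Λ₀, b, hb0, Bc, fun ω m Λ hadm hΛ₀Λ s₀ s₁ hs₀ hs₀₁ hs₁6 hPlow hP'far ↦ ?_⟩
  -- unpack `Λ ≥ Λ₀`
  have hΛ132 : 132 ≤ Λ := by
    refine le_trans ?_ hΛ₀Λ
    rw [hΛ₀def]; exact le_max_left _ _
  have hΛct : 3584 / ct ≤ Λ := by
    refine le_trans ?_ hΛ₀Λ
    rw [hΛ₀def]; exact (le_max_left _ _).trans (le_max_right _ _)
  have hΛB : 13248 * M ^ 3 / K ≤ Λ := by
    refine le_trans ?_ hΛ₀Λ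
    rw [hΛ₀def]; exact (le_max_right _ _).trans (le_max_right _ _)
  have hΛ : 0 < Λ := by linarith only [hΛ132]
  have hs₀M : M ≤ s₀ := hrp.le.trans hs₀
  have hs₀0 : 0 < s₀ := hM.trans_le hs₀M
  have hs₁M : M ≤ s₁ := hs₀M.trans hs₀₁
  have hs₁0 : 0 < s₁ := hM.trans_le hs₁M
  -- the function `g = (r² + a²)³ dV/dr`
  set V := sepPotential M a ω m Λ with hV
  set g : ℝ → ℝ := fun s ↦ (s ^ 2 + a ^ 2) ^ 3 * deriv V s with hg
  have hg_eq : ∀ s, 0 < s → g s = critPoly M a ω m Λ s +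
      (s ^ 2 + a ^ 2) ^ 3 * deriv (sepPotential₁ M a) s :=
    fun s hs ↦ cube_mul_deriv_sepPotential_eq M a ω m Λ hs
  have hg_hasDeriv : ∀ s, 0 < s → HasDerivAt g (deriv g s) s := fun s hs ↦
    (hasDerivAt_cube_mul_deriv_sepPotential M a ω m Λ hs).differentiableAt.hasDerivAt
  have hg_cont : ContinuousOn g (Ioi 0) := fun s hs ↦
    ((hasDerivAt_cube_mul_deriv_sepPotential M a ω m Λ
      (show (0 : ℝ) < s from hs)).continuousAt).continuousWithinAt
  have hg'_le : ∀ s, M ≤ s → deriv g s ≤ critPolyDeriv M a ω m Λ s + 1792 * M * s :=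
    fun s hs ↦ by
    have h := abs_deriv_cube_mul_deriv_sepPotential_sub_le (ω := ω) (Λ := Λ) (m := m) hM haM' hs
    have h' := (abs_sub_le_iff.1 h).1
    linarith only [h']
  have hVg : ∀ s, 0 < s → deriv V s = g s / (s ^ 2 + a ^ 2) ^ 3 := fun s hs ↦ by
    have hDs : (s ^ 2 + a ^ 2) ^ 3 ≠ 0 := by positivity
    rw [hg, mul_div_cancel_left₀ _ hDs]
  -- `g ≥ (K/2)Λ` on `[s₀, s₁]`
  have hglow : ∀ r ∈ Icc s₀ s₁, K / 2 * Λ ≤ g r := by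
    intro r hr
    have hrM : M ≤ r := hs₀M.trans hr.1
    have hr0 : 0 < r := hM.trans_le hrM
    have hr6 : r ≤ 6 * M := hr.2.trans hs₁6
    rw [hg_eq r hr0]
    have h1 := hPlow r hr
    have h2 := abs_cube_mul_deriv_sepPotential₁_le hM haM' hrM
    have hprod : 0 ≤ (6 * M - r) * (6 * M + r) :=
      mul_nonneg (by linarith only [hr6]) (by linarith only [hrM, hM])
    have hr2 : r ^ 2 ≤ 36 * M ^ 2 := by nlinarith only [hprod]
    have h3 := mul_le_mul_of_nonneg_left hr2 (by positivity : (0 : ℝ) ≤ 184 * M)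
    have h4 : 6624 * M ^ 3 ≤ K / 2 * Λ := by
      rw [div_le_iff₀ hK] at hΛB
      linarith only [hΛB]
    linarith only [h1, h2, h3, h4, neg_abs_le ((r ^ 2 + a ^ 2) ^ 3 * deriv (sepPotential₁ M a) r)]
  -- `dg/dr ≤ −(c̃/2)Λs²` on `[s₁, ∞)`
  have hg'far : ∀ s ∈ Ici s₁, deriv g s ≤ -(ct / 2 * Λ * s ^ 2) := by
    intro s hs
    have hsM : M ≤ s := hs₁M.trans hs
    have h1 := hg'_le s hsM
    have h2 := hP'far s hs
    have hctΛ : 3584 ≤ ct * Λ := by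
      rw [div_le_iff₀ hct0] at hΛct; linarith only [hΛct]
    have hs0 : 0 < s := hM.trans_le hsM
    have e1 : 3584 * (M * s) ≤ ct * Λ * (M * s) :=
      mul_le_mul_of_nonneg_right hctΛ (by positivity)
    have e2 : ct * Λ * (M * s) ≤ ct * Λ * (s * s) := by
      apply mul_le_mul_of_nonneg_left _ (by positivity)
      exact mul_le_mul_of_nonneg_right hsM (by linarith only [hsM, hM])
    linarith only [h1, h2, e1, e2]
  -- `g < 0` on `[7M, ∞)`
  have hgneg7 : ∀ r, 7 * M ≤ r → g r < 0 := by
    intro r hr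
    have hr0 : 0 < r := by linarith only [hr, hM]
    have hrM : M ≤ r := by linarith only [hr, hM]
    rw [hg_eq r hr0]
    have h1 := critPoly_le_of_seven_mul_le hM haM' hadm hr
    have h2 := abs_cube_mul_deriv_sepPotential₁_le hM haM' hrM
    have h3 : 920 * M < Λ * r := by
      nlinarith only [hΛ132, hr, hM, mul_nonneg (sub_nonneg.2 hΛ132) (sub_nonneg.2 hr)]
    have h4 := mul_lt_mul_of_pos_right h3 (pow_pos hr0 2)
    linarith only [h1, h2, h4, le_abs_self ((r ^ 2 + a ^ 2) ^ 3 * deriv (sepPotential₁ M a) r)]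
  -- `g` is strictly decreasing on `[s₁, ∞)`
  have hganti : StrictAntiOn g (Ici s₁) :=
    strictAntiOn_of_deriv_neg (convex_Ici _) (hg_cont.mono fun x hx ↦ hs₁0.trans_le hx)
      (fun x hx ↦ by
        rw [interior_Ici] at hx
        have hx' : s₁ < x := hx
        have hx0 : 0 < x := hs₁0.trans hx'
        have h1 := hg'far x hx'.le
        have h2 : 0 < ct / 2 * Λ * x ^ 2 := by positivity
        linarith only [h1, h2])
  -- `r_max`: the zero of `g` in `(s₁, 7M)`
  have hs₁7 : s₁ ≤ 7 * M := by linarith only [hs₁6, hM]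
  have hgs₁ : 0 < g s₁ :=
    lt_of_lt_of_le (by positivity) (hglow s₁ ⟨hs₀₁, le_rfl⟩)
  have hg7 : g (7 * M) < 0 := hgneg7 _ le_rfl
  obtain ⟨rmax, hrmax, hgrmax⟩ : ∃ rmax ∈ Ioo s₁ (7 * M), g rmax = 0 := by
    have hcont7 : ContinuousOn g (Icc s₁ (7 * M)) := hg_cont.mono fun x hx ↦ hs₁0.trans_le hx.1
    exact intermediate_value_Ioo' hs₁7 hcont7 ⟨hg7, hgs₁⟩
  have hrmax0 : 0 < rmax := hs₁0.trans hrmax.1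
  have hrmaxs₀ : s₀ < rmax := hs₀₁.trans_lt hrmax.1
  have hrmaxM : M ≤ rmax := hs₁M.trans hrmax.1.le
  have hDm : 0 < rmax ^ 2 + a ^ 2 := by positivity
  -- the sign of `dV/dr`
  have hgpos : ∀ r ∈ Ico s₀ rmax, 0 < g r := by
    intro r hr
    rcases le_or_gt r s₁ with h | h
    · exact lt_of_lt_of_le (by positivity) (hglow r ⟨hr.1, h⟩)
    · have := hganti (show r ∈ Ici s₁ from h.le) (show rmax ∈ Ici s₁ from hrmax.1.le) hr.2
      linarith only [this, hgrmax]
  have hgneg : ∀ r ∈ Ioi rmax, g r < 0 := by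
    intro r hr
    have hr' : rmax < r := hr
    have := hganti (show rmax ∈ Ici s₁ from hrmax.1.le)
      (show r ∈ Ici s₁ from (hrmax.1.trans hr').le) hr'
    linarith only [this, hgrmax]
  have hVpos : ∀ r ∈ Ico s₀ rmax, 0 < deriv V r := by
    intro r hr
    have hr0 : 0 < r := hs₀0.trans_le hr.1
    rw [hVg r hr0]
    exact div_pos (hgpos r hr) (by positivity)
  have hVzero : deriv V rmax = 0 := by rw [hVg rmax hrmax0, hgrmax, zero_div]
  have hVneg : ∀ r ∈ Ioi rmax, deriv V r < 0 := by
    intro r hr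
    have hr0 : 0 < r := hrmax0.trans hr
    rw [hVg r hr0]
    exact div_neg_of_neg_of_pos (hgneg r hr) (by positivity)
  -- `r_max` is the maximum of `V` on `[s₀, ∞)`
  have hVcont : ContinuousOn V (Ici s₀) :=
    continuousOn_sepPotential M a ω m Λ (fun x hx ↦ hs₀0.trans_le hx)
  have hVmono : StrictMonoOn V (Icc s₀ rmax) :=
    strictMonoOn_of_deriv_pos (convex_Icc _ _) (hVcont.mono Icc_subset_Ici_self)
      (by
        rw [interior_Icc]
        exact fun x hx ↦ hVpos x ⟨hx.1.le, hx.2⟩)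
  have hVanti : StrictAntiOn V (Ici rmax) :=
    strictAntiOn_of_deriv_neg (convex_Ici _) (hVcont.mono fun x hx ↦ hrmaxs₀.le.trans hx)
      (by rw [interior_Ici]; exact hVneg)
  have hVmax : IsMaxOn V (Ici s₀) rmax := by
    refine isMaxOn_iff.2 fun r hr ↦ ?_
    rcases lt_trichotomy r rmax with h | rfl | h
    · exact (hVmono ⟨hr, h.le⟩ ⟨hrmaxs₀.le, le_rfl⟩ h).le
    · exact le_rfl
    · exact (hVanti self_mem_Ici h.le h).le
  -- `|r_max − z| ≤ B/Λ` for every zero `z ≥ s₁` of `P`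
  have hPanti := (convex_Ici s₁).image_sub_le_mul_sub_of_deriv_le
    (continuous_critPoly M a ω m Λ).continuousOn
    (fun x _ ↦ (hasDerivAt_critPoly M a ω m Λ x).differentiableAt.differentiableWithinAt)
    (C := -(ct * Λ * M ^ 2))
    (fun x hx ↦ by
      rw [interior_Ici] at hx
      have hx' : s₁ < x := hx
      rw [deriv_critPoly]
      have h1 := hP'far x hx'.le
      have hxM : M ≤ x := hs₁M.trans hx'.le
      have h2 : ct * Λ * M ^ 2 ≤ ct * Λ * x ^ 2 := by
        apply mul_le_mul_of_nonneg_left _ (by positivity)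
        exact pow_le_pow_left₀ hM.le hxM 2
      linarith only [h1, h2])
  have hPrmax : |critPoly M a ω m Λ rmax| ≤ 9016 * M ^ 3 := by
    have e : critPoly M a ω m Λ rmax =
        -((rmax ^ 2 + a ^ 2) ^ 3 * deriv (sepPotential₁ M a) rmax) := by
      have := hg_eq rmax hrmax0; linarith only [this, hgrmax]
    rw [e, abs_neg]
    have h2 := abs_cube_mul_deriv_sepPotential₁_le hM haM' hrmaxM
    have hprod : 0 ≤ (7 * M - rmax) * (7 * M + rmax) :=
      mul_nonneg (by linarith only [hrmax.2]) (by linarith only [hrmaxM, hM])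
    have hr2 : rmax ^ 2 ≤ 49 * M ^ 2 := by nlinarith only [hprod]
    have h3 := mul_le_mul_of_nonneg_left hr2 (by positivity : (0 : ℝ) ≤ 184 * M)
    linarith only [h2, h3]
  have hdist : ∀ z ∈ Ici s₁, critPoly M a ω m Λ z = 0 → |rmax - z| ≤ Bc / Λ := by
    intro z hz hPz
    have hkey : ct * Λ * M ^ 2 * |rmax - z| ≤ 9016 * M ^ 3 := by
      rcases le_or_gt rmax z with h | h
      · have h1 := hPanti rmax (show rmax ∈ Ici s₁ from hrmax.1.le) z hz h
        rw [hPz] at h1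
        rw [abs_of_nonpos (sub_nonpos.2 h)]
        linarith only [h1, hPrmax, le_abs_self (critPoly M a ω m Λ rmax)]
      · have h1 := hPanti z hz rmax (show rmax ∈ Ici s₁ from hrmax.1.le) h.le
        rw [hPz] at h1
        rw [abs_of_pos (sub_pos.2 h)]
        linarith only [h1, hPrmax, neg_abs_le (critPoly M a ω m Λ rmax)]
    have e : Bc / Λ = 9016 * M ^ 3 / (ct * Λ * M ^ 2) := by
      rw [hBcdef]; field_simp
    rw [e, le_div_iff₀ (by positivity)]
    linarith only [hkey]
  -- `bΛ(r − r_max)²/r⁴ ≤ −(r − r_max) dV/dr` on `[s₀, ∞)`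
  have hGd : ∀ x, 0 < x → HasDerivAt (fun s ↦ g s + ct / 6 * Λ * s ^ 3)
      (deriv g x + ct / 2 * Λ * x ^ 2) x := fun x hx ↦
    ((hg_hasDeriv x hx).add ((hasDerivAt_pow 3 x).const_mul (ct / 6 * Λ))).congr_deriv
      (by push_cast; ring)
  have hGanti : AntitoneOn (fun s ↦ g s + ct / 6 * Λ * s ^ 3) (Ici s₁) := by
    refine antitoneOn_of_deriv_nonpos (convex_Ici _) (fun x hx ↦ ?_) (fun x hx ↦ ?_)
      (fun x hx ↦ ?_)
    · exact (hGd x (hs₁0.trans_le hx)).continuousAt.continuousWithinAt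
    · rw [interior_Ici] at hx
      exact (hGd x (hs₁0.trans hx)).differentiableAt.differentiableWithinAt
    · rw [interior_Ici] at hx
      have hx' : s₁ < x := hx
      rw [(hGd x (hs₁0.trans hx')).deriv]
      have h1 := hg'far x hx'.le
      linarith only [h1]
  have hGrmax : g rmax + ct / 6 * Λ * rmax ^ 3 = ct / 6 * Λ * rmax ^ 3 := by
    rw [hgrmax, zero_add]
  have hVdeg : ∀ r ∈ Ici s₀,
      b * Λ * (r - rmax) ^ 2 / r ^ 4 ≤ -((r - rmax) * deriv V r) := by
    intro r hr
    have hr' : s₀ ≤ r := hr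
    have hrM : M ≤ r := hs₀M.trans hr'
    have hr0 : 0 < r := hM.trans_le hrM
    have hD : 0 < r ^ 2 + a ^ 2 := by positivity
    have har : a ^ 2 ≤ r ^ 2 := ha2.trans (pow_le_pow_left₀ hM.le hrM 2)
    have hD8 : (r ^ 2 + a ^ 2) ^ 3 ≤ 8 * r ^ 6 := by
      have h2r : r ^ 2 + a ^ 2 ≤ 2 * r ^ 2 := by linarith only [har]
      calc (r ^ 2 + a ^ 2) ^ 3 ≤ (2 * r ^ 2) ^ 3 := by gcongr
        _ = 8 * r ^ 6 := by ring
    rw [hVg r hr0]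
    rcases lt_or_ge r s₁ with hrs₁ | hrs₁
    · -- `s₀ ≤ r < s₁`: `g ≥ (K/2)Λ`
      have hgr := hglow r ⟨hr', hrs₁.le⟩
      have hgr0 : 0 ≤ g r := le_trans (by positivity) hgr
      have hrm : 0 ≤ rmax - r := by linarith only [hrmax.1, hrs₁]
      have hrm7 : rmax - r ≤ 7 * M := by linarith only [hrmax.2, hr0]
      have hr6 : r ≤ 6 * M := hrs₁.le.trans hs₁6
      have e : -((r - rmax) * (g r / (r ^ 2 + a ^ 2) ^ 3)) =
          (rmax - r) * g r / (r ^ 2 + a ^ 2) ^ 3 := by ring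
      rw [e]
      have step1 : b * Λ * (r - rmax) ^ 2 / r ^ 4 ≤
          K / (4032 * M ^ 3) * Λ * (rmax - r) ^ 2 / r ^ 4 := by
        have : (r - rmax) ^ 2 = (rmax - r) ^ 2 := by ring
        rw [this]
        gcongr
      have step2 : K / (4032 * M ^ 3) * Λ * (rmax - r) ^ 2 / r ^ 4 ≤
          (rmax - r) * (K / 2 * Λ) / (8 * r ^ 6) := by
        rw [div_le_div_iff₀ (by positivity) (by positivity)]
        have hprod : 0 ≤ (6 * M - r) * (6 * M + r) :=
          mul_nonneg (by linarith only [hr6]) (by linarith only [hrM, hM])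
        have hr2 : r ^ 2 ≤ 36 * M ^ 2 := by nlinarith only [hprod]
        have hkey : (rmax - r) * r ^ 2 ≤ 252 * M ^ 3 := by
          calc (rmax - r) * r ^ 2 ≤ (7 * M) * (36 * M ^ 2) :=
                mul_le_mul hrm7 hr2 (by positivity) (by positivity)
            _ = 252 * M ^ 3 := by ring
        have e1 : K / (4032 * M ^ 3) * Λ * (rmax - r) ^ 2 * (8 * r ^ 6) =
            (K * Λ * (rmax - r) * r ^ 4 / (504 * M ^ 3)) * ((rmax - r) * r ^ 2) := by
          field_simp; ring
        have e2 : (rmax - r) * (K / 2 * Λ) * r ^ 4 =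
            (K * Λ * (rmax - r) * r ^ 4 / (504 * M ^ 3)) * (252 * M ^ 3) := by
          field_simp; ring
        rw [e1, e2]
        exact mul_le_mul_of_nonneg_left hkey (by positivity)
      have step3 : (rmax - r) * (K / 2 * Λ) / (8 * r ^ 6) ≤
          (rmax - r) * g r / (r ^ 2 + a ^ 2) ^ 3 := by
        calc (rmax - r) * (K / 2 * Λ) / (8 * r ^ 6) ≤ (rmax - r) * g r / (8 * r ^ 6) :=
              div_le_div_of_nonneg_right (mul_le_mul_of_nonneg_left hgr hrm) (by positivity)
          _ ≤ (rmax - r) * g r / (r ^ 2 + a ^ 2) ^ 3 :=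
              div_le_div_of_nonneg_left (mul_nonneg hrm hgr0) (by positivity) hD8
      exact step1.trans (step2.trans step3)
    · -- `r ≥ s₁`: compare `G(r)` with `G(r_max)`
      have hb48 : b * Λ * (r - rmax) ^ 2 / r ^ 4 ≤ ct / 48 * Λ * (r - rmax) ^ 2 / r ^ 4 := by
        gcongr
      have e48 : ct / 48 * Λ * (r - rmax) ^ 2 / r ^ 4 =
          ct / 6 * Λ * (r - rmax) ^ 2 * r ^ 2 / (8 * r ^ 6) := by
        field_simp; ring
      have step2 : ct / 6 * Λ * (r - rmax) ^ 2 * r ^ 2 / (8 * r ^ 6) ≤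
          ct / 6 * Λ * (r - rmax) ^ 2 * r ^ 2 / (r ^ 2 + a ^ 2) ^ 3 :=
        div_le_div_of_nonneg_left (by positivity) (by positivity) hD8
      refine hb48.trans (e48.le.trans (step2.trans ?_))
      rw [show -((r - rmax) * (g r / (r ^ 2 + a ^ 2) ^ 3)) =
        -((r - rmax) * g r) / (r ^ 2 + a ^ 2) ^ 3 by ring,
        div_le_div_iff_of_pos_right (pow_pos hD 3)]
      rcases le_or_gt rmax r with hle | hgt
      · -- `r ≥ r_max`: `g r ≤ −(c̃/6)Λ(r³ − r_max³)`
        have hG := hGanti (show rmax ∈ Ici s₁ from hrmax.1.le) (show r ∈ Ici s₁ from hrs₁) hle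
        simp only at hG
        rw [hGrmax] at hG
        have hg1 : g r ≤ -(ct / 6 * Λ * (r ^ 3 - rmax ^ 3)) := by linarith only [hG]
        have hint : 0 ≤ rmax * (r - rmax) * (r + rmax) :=
          mul_nonneg (mul_nonneg hrmax0.le (sub_nonneg.2 hle)) (by positivity)
        have hcub : (r - rmax) * r ^ 2 ≤ r ^ 3 - rmax ^ 3 := by linarith only [hint]
        have h1 := mul_le_mul_of_nonneg_left hcub
          (by positivity : (0 : ℝ) ≤ ct / 6 * Λ * (r - rmax))
        have h2 := mul_le_mul_of_nonneg_left hg1 (sub_nonneg.2 hle)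
        linarith only [h1, h2]
      · -- `s₁ ≤ r < r_max`: `g r ≥ (c̃/6)Λ(r_max³ − r³)`
        have hG := hGanti (show r ∈ Ici s₁ from hrs₁) (show rmax ∈ Ici s₁ from hrmax.1.le) hgt.le
        simp only at hG
        rw [hGrmax] at hG
        have hg1 : ct / 6 * Λ * (rmax ^ 3 - r ^ 3) ≤ g r := by linarith only [hG]
        have hint : 0 ≤ rmax * (rmax - r) * (rmax + r) :=
          mul_nonneg (mul_nonneg hrmax0.le (sub_nonneg.2 hgt.le)) (by positivity)
        have hcub : (rmax - r) * r ^ 2 ≤ rmax ^ 3 - r ^ 3 := by linarith only [hint]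
        have h1 := mul_le_mul_of_nonneg_left hcub
          (by positivity : (0 : ℝ) ≤ ct / 6 * Λ * (rmax - r))
        have h2 := mul_le_mul_of_nonneg_left hg1 (sub_nonneg.2 hgt.le)
        linarith only [h1, h2]
  -- `d²V/dr²(r_max) ≤ −bΛ`
  have hderiv2 : deriv (deriv V) rmax = deriv g rmax / (rmax ^ 2 + a ^ 2) ^ 3 := by
    have hq := (hg_hasDeriv rmax hrmax0).div (hasDerivAt_sq_add_sq_pow a 3 rmax)
      (pow_ne_zero 3 hDm.ne')
    have heq : deriv V =ᶠ[𝓝 rmax] fun s ↦ g s / (s ^ 2 + a ^ 2) ^ 3 := by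
      filter_upwards [Ioi_mem_nhds hrmax0] with s hs
      exact hVg s hs
    rw [(hq.congr_of_eventuallyEq heq).deriv, hgrmax, zero_mul, sub_zero,
      pow_two ((rmax ^ 2 + a ^ 2) ^ 3), mul_div_mul_right _ _ (pow_ne_zero 3 hDm.ne')]
  have hnondeg : deriv (deriv V) rmax ≤ -(b * Λ) := by
    rw [hderiv2, div_le_iff₀ (pow_pos hDm 3)]
    have h1 := hg'far rmax hrmax.1.le
    have har : a ^ 2 ≤ rmax ^ 2 := ha2.trans (pow_le_pow_left₀ hM.le hrmaxM 2)
    have hD8 : (rmax ^ 2 + a ^ 2) ^ 3 ≤ 8 * rmax ^ 6 := by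
      have h2r : rmax ^ 2 + a ^ 2 ≤ 2 * rmax ^ 2 := by linarith only [har]
      calc (rmax ^ 2 + a ^ 2) ^ 3 ≤ (2 * rmax ^ 2) ^ 3 := by gcongr
        _ = 8 * rmax ^ 6 := by ring
    have h2 : b * Λ * (8 * rmax ^ 6) ≤ ct / 2 * Λ * rmax ^ 2 := by
      have hr4 : rmax ^ 4 ≤ 2401 * M ^ 4 := by
        calc rmax ^ 4 ≤ (7 * M) ^ 4 := pow_le_pow_left₀ hrmax0.le hrmax.2.le 4
          _ = 2401 * M ^ 4 := by ring
      have e1 : b * Λ * (8 * rmax ^ 6) = (8 * b * Λ * rmax ^ 2) * rmax ^ 4 := by ring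
      have e2 : ct / 2 * Λ * rmax ^ 2 = (ct / (4802 * M ^ 4) * Λ * rmax ^ 2) * (2401 * M ^ 4) := by
        field_simp; ring
      rw [e1, e2]
      have h8b : 8 * b ≤ ct / (4802 * M ^ 4) := by
        rw [le_div_iff₀ (by positivity)] at hb4 ⊢
        linarith only [hb4]
      calc (8 * b * Λ * rmax ^ 2) * rmax ^ 4 ≤ (8 * b * Λ * rmax ^ 2) * (2401 * M ^ 4) := by
            gcongr
        _ ≤ (ct / (4802 * M ^ 4) * Λ * rmax ^ 2) * (2401 * M ^ 4) := by gcongr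
    have h3 : -(b * Λ) * (8 * rmax ^ 6) ≤ -(b * Λ) * (rmax ^ 2 + a ^ 2) ^ 3 :=
      mul_le_mul_of_nonpos_left hD8 (by nlinarith only [hb0, hΛ])
    linarith only [h1, h2, h3]
  -- the quantitative gap `r_max − s₁ ≥ K/(3720M²)` (`g(s₁) ≥ (K/2)Λ`, `|dg/dr| ≤ 1860ΛM²` on `[M, 7M]`)
  have hgap : s₁ + K / (3720 * M ^ 2) ≤ rmax := by
    have hmvt := (convex_Icc s₁ rmax).mul_sub_le_image_sub_of_le_deriv
      (hg_cont.mono fun x hx ↦ hs₁0.trans_le hx.1)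
      (fun x hx ↦ by
        rw [interior_Icc] at hx
        exact (hg_hasDeriv x (hs₁0.trans hx.1)).differentiableAt.differentiableWithinAt)
      (C := -(1860 * Λ * M ^ 2))
      (fun x hx ↦ by
        rw [interior_Icc] at hx
        have hxM : M ≤ x := hs₁M.trans hx.1.le
        have hx7 : x ≤ 7 * M := hx.2.le.trans hrmax.2.le
        have hx0 : 0 < x := hM.trans_le hxM
        have h1 := abs_deriv_cube_mul_deriv_sepPotential_sub_le (ω := ω) (Λ := Λ) (m := m) hM
          haM' hxM
        have h2 := abs_critPolyDeriv_le hM haM' hadm hxM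
        have hprod : 0 ≤ (7 * M - x) * (7 * M + x) :=
          mul_nonneg (by linarith only [hx7]) (by linarith only [hxM, hM])
        have hx2 : x ^ 2 ≤ 49 * M ^ 2 := by nlinarith only [hprod]
        have h3 : 36 * Λ * x ^ 2 ≤ 1764 * Λ * M ^ 2 := by
          have := mul_le_mul_of_nonneg_left hx2 (by positivity : (0 : ℝ) ≤ 36 * Λ)
          linarith only [this]
        have h4 : 1792 * M * x ≤ 96 * Λ * M ^ 2 := by
          have e1 : 1792 * M * x ≤ 1792 * M * (7 * M) :=
            mul_le_mul_of_nonneg_left hx7 (by positivity)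
          have e2 : 12544 * M ^ 2 ≤ 96 * Λ * M ^ 2 := by nlinarith only [hΛ132, sq_nonneg M]
          linarith only [e1, e2]
        have h5 := (abs_sub_le_iff.1 h1).2
        linarith only [h5, neg_abs_le (critPolyDeriv M a ω m Λ x), h2, h3, h4])
      s₁ (left_mem_Icc.2 hrmax.1.le) rmax (right_mem_Icc.2 hrmax.1.le) hrmax.1.le
    have hgs₁' := hglow s₁ ⟨hs₀₁, le_rfl⟩
    rw [hgrmax] at hmvt
    have hkey : K / 2 * Λ ≤ 1860 * Λ * M ^ 2 * (rmax - s₁) := by linarith only [hmvt, hgs₁']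
    have hΛne : Λ ≠ 0 := hΛ.ne'
    have hMne : M ≠ 0 := hM.ne'
    have hdiv : K / (3720 * M ^ 2) ≤ rmax - s₁ := by
      rw [show K / (3720 * M ^ 2) = (K / 2 * Λ) / (1860 * Λ * M ^ 2) by field_simp; ring]
      rw [div_le_iff₀ (by positivity)]
      linarith only [hkey]
    linarith only [hdiv]
  exact ⟨rmax, hgap, hrmax.2, hVpos, hVzero, hVneg, hVmax, hVdeg, hnondeg, hdist⟩

/-! ### Bounds for `V₀` from bounds for `P` -/

/-- **`V₀(r) ≤ V₀(r₊) + (24Λ/M³)(r − r₊)`** for `r ≥ r₊` (`0 < M`, `|a| ≤ M`, admissible triple):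
the Lipschitz bound `|dV₀/dr| ≤ 24Λ/r³ ≤ 24Λ/M³` ("`|dV₀/dr| ≤ B(ε_width)Λr⁻³`, [so] the value
`r₀ − r₊` … is bounded from below", DRSR arXiv:1402.7034, proof of Lemma 8.6.1).
[cite: DafermosRodnianskiShlapentokhrothman2014, Lemma 8.6.1 (proof)] -/
theorem sepPotential₀_le_add_mul_sub_rPlus {M a ω Λ : ℝ} {m : ℤ} (hM : 0 < M) (haM : |a| ≤ M)
    (hadm : IsAdmissibleTriple a ω m Λ) {r : ℝ} (hr : rPlus M a ≤ r) :
    sepPotential₀ M a ω m Λ r ≤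
      sepPotential₀ M a ω m Λ (rPlus M a) + 24 * Λ / M ^ 3 * (r - rPlus M a) := by
  have hrpM : M ≤ rPlus M a := M_le_rPlus M a
  have hrp0 : 0 < rPlus M a := hM.trans_le hrpM
  have hΛ0 : 0 ≤ Λ := hadm.nonneg
  have hlip : ‖sepPotential₀ M a ω m Λ r - sepPotential₀ M a ω m Λ (rPlus M a)‖ ≤
      24 * Λ / M ^ 3 * ‖r - rPlus M a‖ := by
    refine Convex.norm_image_sub_le_of_norm_deriv_le (fun z hz ↦ ?_) (fun z hz ↦ ?_)
      (convex_Ici (rPlus M a)) (self_mem_Ici) hr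
    · have hz0 : (0 : ℝ) < z := hrp0.trans_le hz
      exact (hasDerivAt_sepPotential₀_critPoly M a ω m Λ
        (by positivity : z ^ 2 + a ^ 2 ≠ 0)).differentiableAt
    · have hzM : M ≤ z := hrpM.trans hz
      have hz0 : 0 < z := hM.trans_le hzM
      rw [Real.norm_eq_abs]
      refine (abs_deriv_sepPotential₀_le hM haM hadm hzM).trans ?_
      apply div_le_div_of_nonneg_left (by positivity : (0 : ℝ) ≤ 24 * Λ) (by positivity)
      exact pow_le_pow_left₀ hM.le hzM 3
  rw [Real.norm_eq_abs, Real.norm_eq_abs, abs_of_nonneg (sub_nonneg.2 hr)] at hlip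
  linarith only [hlip, le_abs_self (sepPotential₀ M a ω m Λ r - sepPotential₀ M a ω m Λ (rPlus M a))]

/-- **If `P ≤ L` (`L ≥ 0`) on `[r₊, 7M]` then `V₀ ≤ V₀(r₊) + 6L/M⁵` on the whole of `[r₊, ∞)`**
(`|a| < M`, admissible triple, `Λ > 0`): on `[r₊, 7M]` by `sepPotential₀_le_add_of_critPoly_le`
(`r − r₊ ≤ 6M`), and `V₀` is strictly decreasing on `[7M, ∞)`
(`deriv_sepPotential₀_neg_of_seven_mul_le`). With `L = P(r₁)`, the value at the turning point, this
is the case "`r₃ = ∞`" of DRSR arXiv:1402.7034, Lemma 8.6.1 (when the hump of `V₀` is too low to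
matter, `V₀ ≤ V₀(r₊) + (3c/4)Λ` throughout). [cite: DafermosRodnianskiShlapentokhrothman2014, Lemma 8.6.1 (proof)] -/
theorem sepPotential₀_le_of_critPoly_le {M a ω Λ L : ℝ} {m : ℤ} (hMa : IsSubextremal M a)
    (hadm : IsAdmissibleTriple a ω m Λ) (hΛ : 0 < Λ) (hL : 0 ≤ L)
    (hP : ∀ r ∈ Icc (rPlus M a) (7 * M), critPoly M a ω m Λ r ≤ L) :
    ∀ r ∈ Ici (rPlus M a),
      sepPotential₀ M a ω m Λ r ≤ sepPotential₀ M a ω m Λ (rPlus M a) + 6 * L / M ^ 5 := by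
  have hM := hMa.pos
  have hrpM : M ≤ rPlus M a := M_le_rPlus M a
  have hrp0 : 0 < rPlus M a := hM.trans_le hrpM
  have hrp2 : rPlus M a ≤ 2 * M := by
    have : √(M ^ 2 - a ^ 2) ≤ M := by
      rw [Real.sqrt_le_left hM.le]; linarith only [sq_nonneg a]
    unfold rPlus; linarith only [this]
  have hnear : ∀ r ∈ Icc (rPlus M a) (7 * M),
      sepPotential₀ M a ω m Λ r ≤ sepPotential₀ M a ω m Λ (rPlus M a) + 6 * L / M ^ 5 := by
    intro r hr
    have h1 := sepPotential₀_le_add_of_critPoly_le (ω := ω) (Λ := Λ) (m := m) hM hL hP r hr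
    have h2 : L / M ^ 6 * (r - rPlus M a) ≤ 6 * L / M ^ 5 := by
      have hd : r - rPlus M a ≤ 6 * M := by linarith only [hr.2, hrpM]
      calc L / M ^ 6 * (r - rPlus M a) ≤ L / M ^ 6 * (6 * M) :=
            mul_le_mul_of_nonneg_left hd (by positivity)
        _ = 6 * L / M ^ 5 := by field_simp
    linarith only [h1, h2]
  intro r hr
  rcases le_or_gt r (7 * M) with h7 | h7
  · exact hnear r ⟨hr, h7⟩
  · have hanti : StrictAntiOn (sepPotential₀ M a ω m Λ) (Ici (7 * M)) :=
      strictAntiOn_of_deriv_neg (convex_Ici _)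
        (continuousOn_sepPotential₀ M a ω m Λ (fun x hx ↦ by
          have : 7 * M ≤ x := hx
          show (0 : ℝ) < x; linarith only [this, hM]))
        (fun x hx ↦ by
          rw [interior_Ici] at hx
          exact deriv_sepPotential₀_neg_of_seven_mul_le hMa hadm hΛ (le_of_lt hx))
    have h1 := hanti (self_mem_Ici) (show r ∈ Ici (7 * M) from h7.le) h7
    have h2 := hnear (7 * M) ⟨by linarith only [hrp2, hM], le_rfl⟩
    linarith only [h1, h2]

/-! ### Lemma 8.6.1 -/

/-- **DRSR Lemma 8.6.1 (the structure of `V` in the trapping regime), explicit dichotomy — proved.**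
For `0 < M`, `0 ≤ a < M` and `c > 0` there are `Λ₀`, `d > 0`, `b > 0`, `B` such that for every
admissible triple `(ω, m, Λ)` with `Λ ≥ Λ₀` and `ω² − V₀(r₊) ≥ cΛ`, EITHER `V(r) ≤ ω² − bΛ` for all
`r ≥ r₊` (the case "`r₃ = ∞`"), OR there are `r₃ ∈ [r₊ + d, 6M]` ("`r₃ − r₊ ≥ b(ε_width)`",
"`r₃ ≤ B`") and `r_max ∈ [r₃ + d, 7M)` such that: `V ≤ ω² − bΛ` on `[r₊, r₃]`; `dV/dr > 0` on
`[r₃, r_max)`, `dV/dr(r_max) = 0`, `dV/dr < 0` on `(r_max, ∞)` and `r_max` is the maximum of `V` on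
`[r₃, ∞)` ("the potential `V` has a unique non-degenerate maximum `r_max ∈ [r₃, ∞)`");
`bΛ(r − r_max)²/r⁴ ≤ −(r − r_max)dV/dr(r)` for `r ≥ r₃` and `d²V/dr²(r_max) ≤ −bΛ`
(non-degeneracy); and there is a critical point `r⁰_max ∈ (r₊, 7M)` of `V₀` with `dV₀/dr < 0` on
`(r⁰_max, ∞)` ("`r⁰_max` exists") and `|r_max − r⁰_max| ≤ B/Λ`. The hypothesis `ω² − V₀(r₊) ≥ cΛ`
is the first display of the printed proof; "`ω_high` sufficiently large" is expressed as
`Λ ≥ Λ₀` (in `𝓖_♮`, `Λ ≥ ε_width ω² ≥ ε_width ω²_high`); see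
`exists_sepPotential_trapping_structure_of_isFreqNatural'` for the range form and the module
docstring for the proof. Constants: `K₁ = cM⁵/8`, `δ₂ = min(M, K₁/(5184M²))`, `c̃ = 2δ₂/(3M)`,
`d = min(cM³/192, δ₂, K₁/(14880M²))`, `b = min(b', c/8)` and `Λ₀ = max(Λ₀', 24/(cM²), 1)` with
`Λ₀', b', B` from `exists_sepPotential_structure_of_critPoly_sign` for `K = K₁/4`, `c̃`.
[cite: DafermosRodnianskiShlapentokhrothman2014, Lemma 8.6.1] -/
theorem exists_sepPotential_trapping_structure {M a c : ℝ} (hM : 0 < M) (ha0 : 0 ≤ a)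
    (haM : a < M) (hc : 0 < c) :
    ∃ Λ₀ : ℝ, ∃ d > 0, ∃ b > 0, ∃ B : ℝ, ∀ (ω : ℝ) (m : ℤ) (Λ : ℝ), IsAdmissibleTriple a ω m Λ →
      Λ₀ ≤ Λ → c * Λ ≤ ω ^ 2 - sepPotential₀ M a ω m Λ (rPlus M a) →
      (∀ r ∈ Ici (rPlus M a), sepPotential M a ω m Λ r ≤ ω ^ 2 - b * Λ) ∨
      (∃ r₃ rmax : ℝ, rPlus M a + d ≤ r₃ ∧ r₃ ≤ 6 * M ∧ r₃ + d ≤ rmax ∧ rmax < 7 * M ∧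
        (∀ r ∈ Icc (rPlus M a) r₃, sepPotential M a ω m Λ r ≤ ω ^ 2 - b * Λ) ∧
        (∀ r ∈ Ico r₃ rmax, 0 < deriv (sepPotential M a ω m Λ) r) ∧
        deriv (sepPotential M a ω m Λ) rmax = 0 ∧
        (∀ r ∈ Ioi rmax, deriv (sepPotential M a ω m Λ) r < 0) ∧
        IsMaxOn (sepPotential M a ω m Λ) (Ici r₃) rmax ∧
        (∀ r ∈ Ici r₃,
          b * Λ * (r - rmax) ^ 2 / r ^ 4 ≤ -((r - rmax) * deriv (sepPotential M a ω m Λ) r)) ∧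
        deriv (deriv (sepPotential M a ω m Λ)) rmax ≤ -(b * Λ) ∧
        (∃ r0max : ℝ, rPlus M a < r0max ∧ r0max < 7 * M ∧
          deriv (sepPotential₀ M a ω m Λ) r0max = 0 ∧
          (∀ r ∈ Ioi r0max, deriv (sepPotential₀ M a ω m Λ) r < 0) ∧
          |rmax - r0max| ≤ B / Λ)) := by
  have haM' : |a| ≤ M := by rw [abs_of_nonneg ha0]; exact haM.le
  have hMa : IsSubextremal M a := show |a| < M by rwa [abs_of_nonneg ha0]
  have hrp : M < rPlus M a := by
    have : 0 < √(M ^ 2 - a ^ 2) := Real.sqrt_pos.2 (by nlinarith only [haM, ha0])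
    unfold rPlus; linarith only [this]
  have hrp0 : 0 < rPlus M a := hM.trans hrp
  have hrpM : M ≤ rPlus M a := hrp.le
  -- the constants
  obtain ⟨K₁, hK₁def⟩ : ∃ K₁ : ℝ, K₁ = c * M ^ 5 / 8 := ⟨_, rfl⟩
  have hK₁0 : 0 < K₁ := by rw [hK₁def]; positivity
  obtain ⟨δ₂, hδ₂def⟩ : ∃ δ₂ : ℝ, δ₂ = min M (K₁ / (5184 * M ^ 2)) := ⟨_, rfl⟩
  have hδ₂0 : 0 < δ₂ := by rw [hδ₂def]; exact lt_min hM (by positivity)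
  have hδ₂M : δ₂ ≤ M := by rw [hδ₂def]; exact min_le_left _ _
  have hδ₂K : δ₂ ≤ K₁ / 2 / (2592 * M ^ 2) := by
    have h : δ₂ ≤ K₁ / (5184 * M ^ 2) := by rw [hδ₂def]; exact min_le_right _ _
    have e : K₁ / (5184 * M ^ 2) = K₁ / 2 / (2592 * M ^ 2) := by
      field_simp; ring
    rwa [e] at h
  obtain ⟨ct, hctdef⟩ : ∃ ct : ℝ, ct = 2 * δ₂ / (3 * M) := ⟨_, rfl⟩
  have hct0 : 0 < ct := by rw [hctdef]; positivity
  obtain ⟨Λe, be, hbe, Be, Heng⟩ :=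
    exists_sepPotential_structure_of_critPoly_sign (K := K₁ / 4) hM ha0 haM (by positivity) hct0
  obtain ⟨d, hddef⟩ : ∃ d : ℝ, d = min (min (c * M ^ 3 / 192) δ₂) (K₁ / 4 / (3720 * M ^ 2)) :=
    ⟨_, rfl⟩
  have hd0 : 0 < d := by
    rw [hddef]; exact lt_min (lt_min (by positivity) hδ₂0) (by positivity)
  have hdc : d ≤ c * M ^ 3 / 192 := by
    rw [hddef]; exact (min_le_left _ _).trans (min_le_left _ _)
  have hdδ₂ : d ≤ δ₂ := by rw [hddef]; exact (min_le_left _ _).trans (min_le_right _ _)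
  have hdgap : d ≤ K₁ / 4 / (3720 * M ^ 2) := by rw [hddef]; exact min_le_right _ _
  obtain ⟨b, hbdef⟩ : ∃ b : ℝ, b = min be (c / 8) := ⟨_, rfl⟩
  have hb0 : 0 < b := by rw [hbdef]; exact lt_min hbe (by positivity)
  have hbbe : b ≤ be := by rw [hbdef]; exact min_le_left _ _
  have hbc : b ≤ c / 8 := by rw [hbdef]; exact min_le_right _ _
  refine ⟨max Λe (max (24 / (c * M ^ 2)) 1), d, hd0, b, hb0, Be, fun ω m Λ hadm hΛ₀Λ hcΛ ↦ ?_⟩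
  -- unpack `Λ ≥ Λ₀`
  have hΛe : Λe ≤ Λ := (le_max_left _ _).trans hΛ₀Λ
  have hΛ24 : 24 / (c * M ^ 2) ≤ Λ := ((le_max_left _ _).trans (le_max_right _ _)).trans hΛ₀Λ
  have hΛ1 : 1 ≤ Λ := ((le_max_right _ _).trans (le_max_right _ _)).trans hΛ₀Λ
  have hΛ : 0 < Λ := one_pos.trans_le hΛ1
  set P := critPoly M a ω m Λ with hPdef
  set V := sepPotential M a ω m Λ with hVdef
  set V₀ := sepPotential₀ M a ω m Λ with hV₀def
  -- `V₁ ≤ (c/8)Λ` on `[r₊, ∞)`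
  have hV₁ : ∀ r, rPlus M a ≤ r → sepPotential₁ M a r ≤ c / 8 * Λ := by
    intro r hr
    have hrM : M ≤ r := hrpM.trans hr
    have h1 := sepPotential₁_le hM haM' hr
    have h2 : 3 * M / r ^ 3 ≤ 3 * M / M ^ 3 := by
      apply div_le_div_of_nonneg_left (by positivity) (by positivity)
      exact pow_le_pow_left₀ hM.le hrM 3
    have h3 : 3 * M / M ^ 3 = 3 / M ^ 2 := by field_simp
    have h4 : 3 / M ^ 2 ≤ c / 8 * Λ := by
      rw [div_le_iff₀ (by positivity)] at hΛ24
      rw [div_le_iff₀ (by positivity)]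
      linarith only [hΛ24]
    linarith only [h1, h2, h3.le, h4]
  have hVsum : ∀ r, V r = V₀ r + sepPotential₁ M a r := fun r ↦ rfl
  -- the turning point `r₁` of `P`
  obtain ⟨r₁, hr₁p, hr₁5, hP'pos, hP'r₁, hP'neg⟩ := exists_critPoly_turningPoint (ω := ω) hMa hadm hΛ
  have hr₁M : M ≤ r₁ := hrpM.trans hr₁p
  have hr₁0 : 0 < r₁ := hM.trans_le hr₁M
  have hPmono : MonotoneOn P (Icc (rPlus M a) r₁) :=
    monotoneOn_of_deriv_nonneg (convex_Icc _ _) (continuous_critPoly M a ω m Λ).continuousOn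
      (fun x _ ↦ (hasDerivAt_critPoly M a ω m Λ x).differentiableAt.differentiableWithinAt)
      (fun x hx ↦ by
        rw [interior_Icc] at hx
        rw [hPdef, deriv_critPoly]
        exact (hP'pos x ⟨hx.1.le, hx.2⟩).le)
  have hPanti : StrictAntiOn P (Ici r₁) :=
    strictAntiOn_of_deriv_neg (convex_Ici _) (continuous_critPoly M a ω m Λ).continuousOn
      (fun x hx ↦ by
        rw [interior_Ici] at hx
        rw [hPdef, deriv_critPoly]
        exact hP'neg x hx)
  have hPle : ∀ r, rPlus M a ≤ r → P r ≤ P r₁ := by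
    intro r hr
    rcases le_or_gt r r₁ with h | h
    · exact hPmono ⟨hr, h⟩ ⟨hr₁p, le_rfl⟩ h
    · exact (hPanti self_mem_Ici h.le h).le
  rcases le_or_gt (P r₁) (K₁ * Λ) with hcase | hcase
  · -- Case `P(r₁) ≤ K₁Λ`: `r₃ = ∞`
    refine Or.inl fun r hr ↦ ?_
    have hr' : rPlus M a ≤ r := hr
    have h1 := sepPotential₀_le_of_critPoly_le (ω := ω) (m := m) hMa hadm hΛ
      (by positivity : 0 ≤ K₁ * Λ) (fun x hx ↦ (hPle x hx.1).trans hcase) r hr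
    have e : 6 * (K₁ * Λ) / M ^ 5 = 3 * c / 4 * Λ := by
      rw [hK₁def]; field_simp; ring
    have h2 := hV₁ r hr'
    have h3 : b * Λ ≤ c / 8 * Λ := mul_le_mul_of_nonneg_right hbc hΛ.le
    rw [hVsum r]
    rw [e] at h1
    linarith only [h1, h2, h3, hcΛ]
  · -- Case `P(r₁) > K₁Λ`: the splitting point `s`
    obtain ⟨s, hsp, hsr₁, hA, hB⟩ : ∃ s : ℝ, rPlus M a ≤ s ∧ s ≤ r₁ ∧
        (∀ r ∈ Icc (rPlus M a) s, V₀ r ≤ V₀ (rPlus M a) + 3 * c / 8 * Λ) ∧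
        (∀ r ∈ Icc s r₁, K₁ / 2 * Λ ≤ P r) := by
      rcases le_or_gt (K₁ / 2 * Λ) (P (rPlus M a)) with hPp | hPp
      · refine ⟨rPlus M a, le_rfl, hr₁p, fun r hr ↦ ?_, fun r hr ↦ ?_⟩
        · have : r = rPlus M a := le_antisymm hr.2 hr.1
          rw [this]
          have : 0 ≤ 3 * c / 8 * Λ := by positivity
          linarith only [this]
        · exact hPp.trans (hPmono ⟨le_rfl, hr₁p⟩ ⟨hr.1, hr.2⟩ hr.1)
      · have hlt : rPlus M a < r₁ := by
          rcases eq_or_lt_of_le hr₁p with h | h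
          · exfalso
            rw [← h] at hcase
            have : K₁ / 2 * Λ ≤ K₁ * Λ := by nlinarith only [hK₁0, hΛ]
            linarith only [hPp, hcase, this]
          · exact h
        have hmem : K₁ / 2 * Λ ∈ Ioo (P (rPlus M a)) (P r₁) := by
          refine ⟨hPp, ?_⟩
          have : K₁ / 2 * Λ < K₁ * Λ := by nlinarith only [hK₁0, hΛ]
          exact this.trans hcase
        obtain ⟨s, hs, hPs⟩ := intermediate_value_Ioo hlt.le
          (continuous_critPoly M a ω m Λ).continuousOn hmem
        refine ⟨s, hs.1.le, hs.2.le, fun r hr ↦ ?_, fun r hr ↦ ?_⟩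
        · have hPr : ∀ x ∈ Icc (rPlus M a) s, P x ≤ K₁ / 2 * Λ := fun x hx ↦ by
            rw [← hPs]
            exact hPmono ⟨hx.1, hx.2.trans hs.2.le⟩ ⟨hs.1.le, hs.2.le⟩ hx.2
          have h1 := sepPotential₀_le_add_of_critPoly_le (ω := ω) (Λ := Λ) (m := m) hM
            (by positivity : 0 ≤ K₁ / 2 * Λ) hPr r hr
          have h2 : K₁ / 2 * Λ / M ^ 6 * (r - rPlus M a) ≤ 3 * c / 8 * Λ := by
            have hd : r - rPlus M a ≤ 6 * M := by
              linarith only [hr.2, hs.2, hr₁5, hrpM, hM]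
            calc K₁ / 2 * Λ / M ^ 6 * (r - rPlus M a) ≤ K₁ / 2 * Λ / M ^ 6 * (6 * M) :=
                  mul_le_mul_of_nonneg_left hd (by positivity)
              _ = 3 * c / 8 * Λ := by rw [hK₁def]; field_simp; ring
          linarith only [h1, h2]
        · rw [← hPs]
          exact hPmono ⟨hs.1.le, hs.2.le⟩ ⟨hs.1.le.trans hr.1, hr.2⟩ hr.1
    have hsM : M ≤ s := hrpM.trans hsp
    -- `s₀ = max(s, r₊ + d)`, `s₁ = r₁ + δ₂`
    set s₀ := max s (rPlus M a + d) with hs₀def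
    set s₁ := r₁ + δ₂ with hs₁def
    have hs₀p : rPlus M a ≤ s₀ := le_max_of_le_right (by linarith only [hd0])
    have hs₀d : rPlus M a + d ≤ s₀ := le_max_right _ _
    have hss₀ : s ≤ s₀ := le_max_left _ _
    have hs₁6 : s₁ ≤ 6 * M := by rw [hs₁def]; linarith only [hr₁5, hδ₂M]
    have hs₀s₁ : s₀ ≤ s₁ := by
      rw [hs₁def]
      refine max_le (by linarith only [hsr₁, hδ₂0]) ?_
      linarith only [hr₁p, hdδ₂]
    -- (E1) `P ≥ (K₁/4)Λ` on `[s₀, s₁]`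
    have hE1' := critPoly_ge_half_of_extend (ω := ω) (m := m) hM haM' hadm
      (by positivity : 0 ≤ K₁ / 2) hsM hsr₁ hs₁6 hδ₂0.le hδ₂K hB
    have hE1 : ∀ r ∈ Icc s₀ s₁, K₁ / 4 * Λ ≤ P r := by
      intro r hr
      have h := hE1' r ⟨hss₀.trans hr.1, hr.2⟩
      have e : K₁ / 2 / 2 * Λ = K₁ / 4 * Λ := by ring
      rwa [e] at h
    -- (E2) `dP/dr ≤ −c̃Λt²` on `[s₁, ∞)`
    have hE2 : ∀ t ∈ Ici s₁, critPolyDeriv M a ω m Λ t ≤ -(ct * Λ * t ^ 2) := by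
      intro t ht
      have h := critPolyDeriv_le_of_turningPoint (ω := ω) (m := m) hM haM' hΛ.le hr₁M hr₁5 hP'r₁
        hδ₂0 hδ₂M (show r₁ + δ₂ ≤ t from ht)
      rwa [hctdef]
    -- the passage to `V`
    obtain ⟨rmax, h1, h2, hpos, hzero, hneg, hmax, hdeg, hnondeg, hdist⟩ :=
      Heng ω m Λ hadm hΛe s₀ s₁ hs₀p hs₀s₁ hs₁6 hE1 hE2
    -- the critical point `r⁰_max` of `V₀`
    have hr₁7 : r₁ < 7 * M := by linarith only [hr₁5, hM]
    have hP7 : P (7 * M) < 0 := critPoly_neg_of_seven_mul_le hMa hadm hΛ le_rfl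
    have hPr₁0 : 0 < P r₁ := lt_trans (by positivity) hcase
    obtain ⟨z, hz, hPz⟩ : ∃ z ∈ Ioo r₁ (7 * M), P z = 0 :=
      intermediate_value_Ioo' hr₁7.le (continuous_critPoly M a ω m Λ).continuousOn ⟨hP7, hPr₁0⟩
    have hz0 : 0 < z := hr₁0.trans hz.1
    have hzs₁ : s₁ ≤ z := by
      by_contra h
      push Not at h
      have h' := hE1' z ⟨hsr₁.trans hz.1.le, h.le⟩
      rw [← hPdef, hPz] at h'
      have : 0 < K₁ / 2 / 2 * Λ := by positivity
      linarith only [h', this]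
    refine Or.inr ⟨s₀, rmax, hs₀d, hs₀s₁.trans hs₁6, by linarith only [hs₀s₁, h1, hdgap], h2,
      fun r hr ↦ ?_, hpos,
      hzero, hneg, hmax, fun r hr ↦ ?_, ?_, z, hr₁p.trans_lt hz.1, hz.2, ?_, fun r hr ↦ ?_,
      hdist z hzs₁ hPz⟩
    · -- `V ≤ ω² − bΛ` on `[r₊, s₀]`
      have hV₀r : V₀ r ≤ V₀ (rPlus M a) + 3 * c / 8 * Λ := by
        rcases le_or_gt r s with h | h
        · exact hA r ⟨hr.1, h⟩
        · have hrd : r ≤ rPlus M a + d := by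
            have := hr.2
            rw [hs₀def] at this
            rcases le_max_iff.1 this with h' | h'
            · exact absurd h' (not_le.2 h)
            · exact h'
          have h1 := sepPotential₀_le_add_mul_sub_rPlus (ω := ω) (Λ := Λ) (m := m) hM haM' hadm hr.1
          have h2 : 24 * Λ / M ^ 3 * (r - rPlus M a) ≤ c / 8 * Λ := by
            have hd' : r - rPlus M a ≤ c * M ^ 3 / 192 := by linarith only [hrd, hdc]
            calc 24 * Λ / M ^ 3 * (r - rPlus M a) ≤ 24 * Λ / M ^ 3 * (c * M ^ 3 / 192) :=
                  mul_le_mul_of_nonneg_left hd' (by positivity)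
              _ = c / 8 * Λ := by field_simp; ring
          have h3 : c / 8 * Λ ≤ 3 * c / 8 * Λ := by nlinarith only [hc, hΛ]
          linarith only [h1, h2, h3]
      have h2 := hV₁ r hr.1
      have h3 : b * Λ ≤ c / 8 * Λ := mul_le_mul_of_nonneg_right hbc hΛ.le
      have h4 : 0 ≤ c * Λ := by positivity
      rw [hVsum r]
      linarith only [hV₀r, h2, h3, h4, hcΛ]
    · -- non-degeneracy with the constant `b ≤ b'`
      have h := hdeg r hr
      have hr0 : 0 < r := (hM.trans_le (hrpM.trans hs₀p)).trans_le hr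
      have : b * Λ * (r - rmax) ^ 2 / r ^ 4 ≤ be * Λ * (r - rmax) ^ 2 / r ^ 4 := by
        gcongr
      exact this.trans h
    · have : -(be * Λ) ≤ -(b * Λ) := by nlinarith only [hbbe, hΛ]
      exact hnondeg.trans this
    · exact (deriv_sepPotential₀_eq_zero_iff M a ω m Λ hz0).2 hPz
    · have hr' : z < r := hr
      rw [deriv_sepPotential₀_neg_iff M a ω m Λ (hz0.trans hr')]
      have := hPanti (show z ∈ Ici r₁ from hz.1.le) (show r ∈ Ici r₁ from (hz.1.trans hr').le) hr'
      rwa [hPz] at this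

/-- **Lemma 8.6.1 phrased with the range `𝓖_♮(ω_high, ε)` (repaired strip): "for all `ω_high`
sufficiently large depending on `ε_width` and for `(ω, m, Λ) ∈ 𝓖_♮(ω_high, ε_width)` …".** For
`0 < M`, `0 ≤ a < M`, `0 < α`, `0 < ε` there are `ω₀`, `d > 0`, `b > 0`, `B` such that for all
`ω_high ≥ ω₀` and all `(ω, m, Λ) ∈ 𝓖_♮(ω_high, ε)` (`IsFreqNatural` with the strip
`IsNearSuperradiant' M a α`: admissible, `ω_high ≤ |ω|`, `εΛ ≤ ω² ≤ ε⁻¹Λ`, off the strip) the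
dichotomy of `exists_sepPotential_trapping_structure` holds (with `c = min(ε, α²)`:
`ω² − V₀(r₊) ≥ min(ε, α²)Λ` off the strip, `KerrFrequencyRanges.min_mul_le_sq_sub_sepPotential₀_rPlus`;
and `Λ ≥ εω² ≥ εω²_high ≥ Λ₀` once `ω_high ≥ √(max(Λ₀, 0)/ε)`).
[cite: DafermosRodnianskiShlapentokhrothman2014, Lemma 8.6.1] -/
theorem exists_sepPotential_trapping_structure_of_isFreqNatural' {M a α ε : ℝ} (hM : 0 < M)
    (ha0 : 0 ≤ a) (haM : a < M) (hα : 0 < α) (hε : 0 < ε) :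
    ∃ ω₀ : ℝ, ∃ d > 0, ∃ b > 0, ∃ B : ℝ, ∀ ωh : ℝ, ω₀ ≤ ωh → ∀ (ω : ℝ) (m : ℤ) (Λ : ℝ),
      IsFreqNatural (IsNearSuperradiant' M a α) a ωh ε ω m Λ →
      (∀ r ∈ Ici (rPlus M a), sepPotential M a ω m Λ r ≤ ω ^ 2 - b * Λ) ∨
      (∃ r₃ rmax : ℝ, rPlus M a + d ≤ r₃ ∧ r₃ ≤ 6 * M ∧ r₃ + d ≤ rmax ∧ rmax < 7 * M ∧
        (∀ r ∈ Icc (rPlus M a) r₃, sepPotential M a ω m Λ r ≤ ω ^ 2 - b * Λ) ∧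
        (∀ r ∈ Ico r₃ rmax, 0 < deriv (sepPotential M a ω m Λ) r) ∧
        deriv (sepPotential M a ω m Λ) rmax = 0 ∧
        (∀ r ∈ Ioi rmax, deriv (sepPotential M a ω m Λ) r < 0) ∧
        IsMaxOn (sepPotential M a ω m Λ) (Ici r₃) rmax ∧
        (∀ r ∈ Ici r₃,
          b * Λ * (r - rmax) ^ 2 / r ^ 4 ≤ -((r - rmax) * deriv (sepPotential M a ω m Λ) r)) ∧
        deriv (deriv (sepPotential M a ω m Λ)) rmax ≤ -(b * Λ) ∧
        (∃ r0max : ℝ, rPlus M a < r0max ∧ r0max < 7 * M ∧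
          deriv (sepPotential₀ M a ω m Λ) r0max = 0 ∧
          (∀ r ∈ Ioi r0max, deriv (sepPotential₀ M a ω m Λ) r < 0) ∧
          |rmax - r0max| ≤ B / Λ)) := by
  have hc : 0 < min ε (α ^ 2) := lt_min hε (by positivity)
  obtain ⟨Λ₀, d, hd, b, hb, B, H⟩ := exists_sepPotential_trapping_structure hM ha0 haM hc
  refine ⟨√(max Λ₀ 0 / ε), d, hd, b, hb, B, fun ωh hωh ω m Λ hG ↦ ?_⟩
  obtain ⟨hadm, hωh', hεΛ, hω2, hS⟩ := hG
  have hω0 : 0 ≤ √(max Λ₀ 0 / ε) := Real.sqrt_nonneg _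
  have hωh0 : 0 ≤ ωh := hω0.trans hωh
  -- `Λ ≥ εω² ≥ εω²_high ≥ max(Λ₀, 0)`
  have hΛ : Λ₀ ≤ Λ := by
    have h1 : max Λ₀ 0 / ε ≤ ωh ^ 2 := by
      calc max Λ₀ 0 / ε = (√(max Λ₀ 0 / ε)) ^ 2 :=
            (Real.sq_sqrt (div_nonneg (le_max_right _ _) hε.le)).symm
        _ ≤ ωh ^ 2 := pow_le_pow_left₀ hω0 hωh 2
    have h2 : ωh ^ 2 ≤ ω ^ 2 := by
      calc ωh ^ 2 ≤ |ω| ^ 2 := pow_le_pow_left₀ hωh0 hωh' 2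
        _ = ω ^ 2 := sq_abs ω
    have h4 : ε * ω ^ 2 ≤ Λ := by
      have := mul_le_mul_of_nonneg_left hω2 hε.le
      rwa [← mul_assoc, mul_inv_cancel₀ hε.ne', one_mul] at this
    have h5 : max Λ₀ 0 = ε * (max Λ₀ 0 / ε) := by field_simp
    calc Λ₀ ≤ max Λ₀ 0 := le_max_left _ _
      _ = ε * (max Λ₀ 0 / ε) := h5
      _ ≤ ε * ωh ^ 2 := mul_le_mul_of_nonneg_left h1 hε.le
      _ ≤ ε * ω ^ 2 := mul_le_mul_of_nonneg_left h2 hε.le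
      _ ≤ Λ := h4
  have hcΛ := min_mul_le_sq_sub_sepPotential₀_rPlus hM ha0 haM.le hα.le hadm hS hεΛ
  exact H ω m Λ hadm hΛ hcΛ

end Kerr

end Literature.Geometry.Lorentzian

end
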